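import Summits.ValiantsHypothesis.ValiantsHypothesis.Theorems.LacunarySymmetroidMatrixDescartesCensusReflectGauss
import Summits.ValiantsHypothesis.ValiantsHypothesis.Theorems.LacunarySymmetroidMatrixDescartesChainLaw

/-!
# `MatrixDescartes` census — RAYS from a reflective certificate: graft ray, self-chain, chain + graft

HONEST FRAMING.  Bookkeeping for the finite census of real symmetric lacunary pencils (cells `pub-symmetroid`,
`val-V1-extremal`; seat val-v1x-eng-8).  LOWER bounds only; nothing about the asymptotic crux
`Theses.LacunarySymmetroid.MatrixDescartes` (stmt-ValiantsHypothesis-18050) nor about `VP ≠ VNP`.  No definitions.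

A reflective certificate (`…CensusReflect.certCheck = true`, eng-10; or `…CensusReflectGauss.certCheckG = true`) is an explicit
alternating configuration: `N + 1` positive rational points at which the determinant of an explicit symmetric integer `K`-letter pencil
alternates.  `alternating_of_certCheck` exposes that configuration (as real data), so the tree's construction calculus applies to it
verbatim: the GRAFT RAY `Graft.not_posRootLawAt_add_of_certificate` (`+m` alternations per added letter), the SELF-CHAIN
`Chain.not_posRootLawAt_chain_of_certificate` (`K+1` letters ↦ `2K+1` letters, `N ↦ 2N`: the pencil chained with its reversal through a
shared end letter) and their composite (`Chain.exists_alternating_chain'` then `Graft.exists_alternating_add`):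
* `graftRay_of_certCheckG : certCheckG m K N d S a b = true → 1 ≤ N → ¬ PosRootLawAt m (K + j) (N + j·m − 1)`;
* `chain_of_certCheckG   : certCheckG m (K+1) N d S a b = true → 1 ≤ N → ¬ PosRootLawAt m (2K + 1) (2N − 1)`;
* `chainGraft_of_certCheckG : … → ¬ PosRootLawAt m (2K + 1 + j) (2N + j·m − 1)`;
and the same three for `certCheck`.  [folklore] (intermediate value theorem + the cell's graft/chain constructions).
-/

-- `Summit.ValiantsHypothesis.ValiantsHypothesis.…` repeats a component by the D-0017 layout
-- (single-conjunct summit), which the `dupNamespace` linter flags; the name is mandated.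
set_option linter.dupNamespace false

namespace Summit.ValiantsHypothesis.ValiantsHypothesis.Theorems.LacunarySymmetroidMatrixDescartes.Census.Reflect

open Summit.ValiantsHypothesis.ValiantsHypothesis.Theorems.MatrixDescartes.Negative (PosRootLawAt)
open Summit.ValiantsHypothesis.ValiantsHypothesis.Theorems.LacunarySymmetroidMatrixDescartes.Census
open scoped BigOperators Matrix

/-- **The alternating configuration behind a reflective certificate.**  If `certCheck m K N d S a b = true` then the real
pencil with integer letters `S` and the points `τ j = a j / b j` form an explicit alternating configuration with `N` sign
changes (letters symmetric, points strictly increasing and positive, nonzero alternating determinants). [folklore] -/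
theorem alternating_of_certCheck {m K N : ℕ} {d : Fin K → ℕ} {S : Fin K → Fin m → Fin m → ℤ}
    {a b : Fin (N + 1) → ℕ} (h : certCheck m K N d S a b = true) (hN : 1 ≤ N) :
    ∃ (SR : Fin K → Matrix (Fin m) (Fin m) ℝ) (τ : Fin (N + 1) → ℝ),
      (∀ l, (SR l).IsSymm) ∧ StrictMono τ ∧ (∀ j, 0 < τ j) ∧ (∀ j, (∑ l, τ j ^ d l • SR l).det ≠ 0) ∧
      ∀ i : Fin N, (∑ l, τ i.castSucc ^ d l • SR l).det * (∑ l, τ i.succ ^ d l • SR l).det < 0 := by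
  simp only [certCheck, Bool.and_eq_true] at h
  obtain ⟨hsymm, hpos, hmono, hsign⟩ := h
  have hS : ∀ l i j, S l i j = S l j i := fun l i j => by
    simpa using of_finAll (of_finAll (of_finAll hsymm l) i) j
  have ha : ∀ j, 0 < a j := fun j => by
    have := of_finAll hpos j; simp only [Bool.and_eq_true, decide_eq_true_eq] at this; exact this.1
  have hb : ∀ j, 0 < b j := fun j => by
    have := of_finAll hpos j; simp only [Bool.and_eq_true, decide_eq_true_eq] at this; exact this.2
  have hlt : ∀ i : Fin N, a i.castSucc * b i.succ < a i.succ * b i.castSucc := fun i => by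
    simpa using of_finAll hmono i
  have hsg : ∀ i : Fin N, signAt m K (finMax K d) d S (a i.castSucc) (b i.castSucc)
      * signAt m K (finMax K d) d S (a i.succ) (b i.succ) = -1 := fun i => by
    simpa using of_finAll hsign i
  let SR : Fin K → Matrix (Fin m) (Fin m) ℝ := fun l => Matrix.of fun i j => (S l i j : ℝ)
  let τ : Fin (N + 1) → ℝ := fun j => (a j : ℝ) / (b j : ℝ)
  have hbR : ∀ j, (0 : ℝ) < b j := fun j => by exact_mod_cast hb j
  have hτpos : ∀ j, 0 < τ j := fun j => div_pos (by exact_mod_cast ha j) (hbR j)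
  have hτ : StrictMono τ := by
    refine Fin.strictMono_iff_lt_succ.mpr (fun i => ?_)
    show (a i.castSucc : ℝ) / b i.castSucc < (a i.succ : ℝ) / b i.succ
    rw [div_lt_div_iff₀ (hbR _) (hbR _)]
    exact_mod_cast hlt i
  have hD : ∀ l, d l ≤ finMax K d := le_finMax d
  have key : ∀ j : Fin (N + 1),
      ((b j : ℝ) ^ finMax K d) ^ m * (∑ l, τ j ^ d l • SR l).det
        = (idet m (evalAt m K (finMax K d) d S (a j) (b j)) : ℝ) := fun j =>
    det_evalAt d hD S (a j) (b j) (ne_of_gt (hbR j))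
  have hc : ∀ j : Fin (N + 1), (0 : ℝ) < ((b j : ℝ) ^ finMax K d) ^ m := fun j =>
    pow_pos (pow_pos (hbR j) _) _
  have halt : ∀ i : Fin N,
      (∑ l, τ i.castSucc ^ d l • SR l).det * (∑ l, τ i.succ ^ d l • SR l).det < 0 := by
    intro i
    have hneg := mul_neg_of_sign (hsg i)
    rw [← key, ← key] at hneg
    have hcc : (0 : ℝ) < ((b i.castSucc : ℝ) ^ finMax K d) ^ m * ((b i.succ : ℝ) ^ finMax K d) ^ m :=
      mul_pos (hc _) (hc _)
    have hprod : ((b i.castSucc : ℝ) ^ finMax K d) ^ m * ((b i.succ : ℝ) ^ finMax K d) ^ m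
        * ((∑ l, τ i.castSucc ^ d l • SR l).det * (∑ l, τ i.succ ^ d l • SR l).det) < 0 := by
      calc ((b i.castSucc : ℝ) ^ finMax K d) ^ m * ((b i.succ : ℝ) ^ finMax K d) ^ m
            * ((∑ l, τ i.castSucc ^ d l • SR l).det * (∑ l, τ i.succ ^ d l • SR l).det)
          = (((b i.castSucc : ℝ) ^ finMax K d) ^ m * (∑ l, τ i.castSucc ^ d l • SR l).det)
            * ((((b i.succ : ℝ) ^ finMax K d) ^ m) * (∑ l, τ i.succ ^ d l • SR l).det) := by ring
        _ < 0 := hneg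
    exact lt_of_not_ge (fun hge => absurd hprod (not_lt.mpr (mul_nonneg hcc.le hge)))
  refine ⟨SR, τ, fun l => realLetters_isSymm hS l, hτ, hτpos, ?_, halt⟩
  exact Graft.ne_zero_of_alternating hN (fun j => (∑ l, τ j ^ d l • SR l).det) halt

/-- **Graft ray from a reflective certificate**: `ζ_sym(m, K + j) ≥ N + j·m`. [folklore] -/
theorem graftRay_of_certCheck {m K N : ℕ} {d : Fin K → ℕ} {S : Fin K → Fin m → Fin m → ℤ}
    {a b : Fin (N + 1) → ℕ} (h : certCheck m K N d S a b = true) (hN : 1 ≤ N) (j : ℕ) :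
    ¬ PosRootLawAt m (K + j) (N + j * m - 1) := by
  obtain ⟨SR, τ, hS, hτ, hpos, -, halt⟩ := alternating_of_certCheck h hN
  exact Graft.not_posRootLawAt_add_of_certificate (q := fun t => (∑ l, t ^ d l • SR l).det) (fun _ => rfl)
    hS τ hτ hpos halt hN j

/-- **Self-chain from a reflective certificate**: a certified `(K+1)`-letter row with `N` alternations gives
`ζ_sym(m, 2K + 1) ≥ 2N`. [folklore] -/
theorem chain_of_certCheck {m K N : ℕ} {d : Fin (K + 1) → ℕ} {S : Fin (K + 1) → Fin m → Fin m → ℤ}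
    {a b : Fin (N + 1) → ℕ} (h : certCheck m (K + 1) N d S a b = true) (hN : 1 ≤ N) :
    ¬ PosRootLawAt m (2 * K + 1) (2 * N - 1) := by
  obtain ⟨SR, τ, hS, hτ, hpos, -, halt⟩ := alternating_of_certCheck h hN
  exact Chain.not_posRootLawAt_chain_of_certificate hN d SR hS τ hτ hpos halt

/-- **Self-chain followed by `j` grafts**: `ζ_sym(m, 2K + 1 + j) ≥ 2N + j·m`. [folklore] -/
theorem chainGraft_of_certCheck {m K N : ℕ} {d : Fin (K + 1) → ℕ} {S : Fin (K + 1) → Fin m → Fin m → ℤ}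
    {a b : Fin (N + 1) → ℕ} (h : certCheck m (K + 1) N d S a b = true) (hN : 1 ≤ N) (j : ℕ) :
    ¬ PosRootLawAt m (2 * K + 1 + j) (2 * N + j * m - 1) := by
  obtain ⟨SR, τ, hS, hτ, hpos, hne, halt⟩ := alternating_of_certCheck h hN
  obtain ⟨d₁, S₁, hd₁, hS₁, hne₁, halt₁⟩ := Graft.exists_alternating_strictMono d SR hS τ hpos hne halt
  obtain ⟨d₂, S₂, τ₂, -, hS₂, hτ₂, hpos₂, hne₂, halt₂⟩ :=
    Chain.exists_alternating_chain' ⟨d₁, S₁, τ, hd₁, hS₁, hτ, hpos, hne₁, halt₁⟩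
  obtain ⟨d₃, S₃, τ₃, hS₃, hτ₃, hpos₃, -, halt₃⟩ :=
    Graft.exists_alternating_add ⟨d₂, S₂, τ₂, hS₂, hτ₂, hpos₂, hne₂, halt₂⟩ j
  exact Graft.not_posRootLawAt_of_alternating (by omega) d₃ S₃ hS₃ τ₃ hτ₃ hpos₃ halt₃

/-- Graft ray from a Gaussian reflective certificate. [folklore] -/
theorem graftRay_of_certCheckG {m K N : ℕ} {d : Fin K → ℕ} {S : Fin K → Fin m → Fin m → ℤ}
    {a b : Fin (N + 1) → ℕ} (h : certCheckG m K N d S a b = true) (hN : 1 ≤ N) (j : ℕ) :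
    ¬ PosRootLawAt m (K + j) (N + j * m - 1) :=
  graftRay_of_certCheck (by rwa [certCheckG_eq] at h) hN j

/-- Self-chain from a Gaussian reflective certificate. [folklore] -/
theorem chain_of_certCheckG {m K N : ℕ} {d : Fin (K + 1) → ℕ} {S : Fin (K + 1) → Fin m → Fin m → ℤ}
    {a b : Fin (N + 1) → ℕ} (h : certCheckG m (K + 1) N d S a b = true) (hN : 1 ≤ N) :
    ¬ PosRootLawAt m (2 * K + 1) (2 * N - 1) :=
  chain_of_certCheck (by rwa [certCheckG_eq] at h) hN

/-- Self-chain + grafts from a Gaussian reflective certificate. [folklore] -/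
theorem chainGraft_of_certCheckG {m K N : ℕ} {d : Fin (K + 1) → ℕ} {S : Fin (K + 1) → Fin m → Fin m → ℤ}
    {a b : Fin (N + 1) → ℕ} (h : certCheckG m (K + 1) N d S a b = true) (hN : 1 ≤ N) (j : ℕ) :
    ¬ PosRootLawAt m (2 * K + 1 + j) (2 * N + j * m - 1) :=
  chainGraft_of_certCheck (by rwa [certCheckG_eq] at h) hN j

/-! ### Smoke test on the kit's toy row `diag(−1,−2) + t·1` (`(2,2)`, 2 alternations): chain ⇒ `ζ(2,3) ≥ 4`. -/

example : ¬ PosRootLawAt 2 3 3 :=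
  chain_of_certCheckG (m := 2) (K := 1) (N := 2) (d := ![0, 1])
    (S := ![![![-1, 0], ![0, -2]], ![![1, 0], ![0, 1]]]) (a := ![1, 3, 4]) (b := ![2, 2, 1])
    (by decide +kernel) (by norm_num)

end Summit.ValiantsHypothesis.ValiantsHypothesis.Theorems.LacunarySymmetroidMatrixDescartes.Census.Reflect
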